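import Mathlib
import Literature.NumberTheory.LFunctions.Zhang2022.Section14Majorant1413
import Literature.NumberTheory.LFunctions.Zhang2022.Section14Summability
import Literature.NumberTheory.LFunctions.Zhang2022.Section7MellinPerTerm
import Literature.NumberTheory.LFunctions.Zhang2022.SkeletonWindowPowers
import Literature.NumberTheory.LFunctions.Zhang2022.ToolkitLemma56ChiTwist
import HarnessLib

/-!
# Zhang (2022) §14, (14.8) first `r`-range: `Typed.Sec14.Eq148leg1` HOLDS — "for `1 < r < D³` we use
# the Mellin transform, Lemma 5.4 (i) and Lemma 5.6" (p. 79), kernel-checked, with a generic prime weight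

Topic `Literature/NumberTheory/LFunctions/Zhang2022` (Landau–Siegel audit tree; verdict-neutral).
Y. Zhang, *Discrete mean estimates and the Landau–Siegel zero*, arXiv:2211.02515v1 (2022)
[Zhang2022LandauSiegel] — **an unrefereed manuscript under adjudication; nothing here asserts or denies
its Theorems 1–2 or Proposition 14.1.** ZHANG-L discharge lane (WP14; helper under the leaf
`Skeleton.Prop141`, node `Z22:(14.8)`, GAP row G-adj2-4 "the two final estimates of the proof of
Prop 14.1 … the (14.8)-left-side bound `≪ P²D^{−c}` carried out for `1 < r < D³` (Mellin + L5.4(i) + L5.6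
leg)"). The manuscript's text for this leg is one sentence (p. 79, tex L3960–L3962): "The range for `r`
is divided into two parts according to `1 < r < D³` and `D³ ≤ r < 2DP₄`; for `1 < r < D³` we use the
Mellin transform, Lemma 5.4 (i) and Lemma 5.6". The typed claim is `Typed.Sec14.Eq148leg1`
(`TypedSection14.lean`, decl wanted by G-adj2-4): the `r < D³` part of the u017 majorant
`rhs1417On χ κ* S` is `≤ C·P²·D^{−c}` for all large `D` under (A), for all `κ*, a*` with (14.1)–(14.2).

PROVED here (`eq148leg1_holds`, constants `c = 1`, `C = 1`; theorems only, no new definitions, no new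
named facts; every analytic input is a tree theorem). The route is the REPAIRED §7 route of the tree
(GAP G-adj2-2: exact Mellin weight `|δ(1+it)|` split at `|t| = D/2`, rapid decay of `δ` beyond), which
the cell `siegel-zhang` packaged for arbitrary prime coefficients in
`Skeleton.norm_sum_primeWindow_mul_DeltaW_le_of_bounds` (`Section7MellinPerTerm`), combined with

* the Lemma-5.6 input for the product character `χθ̄` (`Skeleton.lemma56_chi_mul_inv`,
  `ToolkitLemma56ChiTwist`; the moduli `Dr < D⁴ ≤ T`, `pow_four_le_bigT`);
* the `l`-aggregation `norm_tsum_le_of_perTerm` — stated for a GENERIC prime weight `a(p)`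
  (`|a(p)| ≤ A₀`) and ANY series dominated termwise by `|κ*(dl)|·|Σ_{p∼P} a(p)Δ(l/(pX))|`, so that the
  general-`β` form of Proposition 14.1 (`a(p) = χθ̄(p)(pt₀)^β`) and the modulus-`D₂k` twin of (14.6) can
  reuse it unchanged: head `l ≤ 2P²t₀^{1.02}` by the per-term bound and `Σ_{l≤N} d(l)⁴/l ≤ (1+log N)¹⁶`
  (`sum_card_divisors_pow_div_le_log_pow`), tail by Lemma 5.3 (5.9) (`divisors_pow_mul_norm_DeltaW_le_tail`,
  `Skeleton.lemma53_holds`), (14.1) in the form `|κ*(dl)| ≤ B·d(d)⁴d(l)⁴`;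
* the per-character power saving `smallConductor_tsum_le`: `‖Σ_l …‖ ≤ C·d(d)⁴·hr·P²·D^{−A}` for every
  `A` (`1 < r < D³`, `θ` primitive mod `r`, `θ ≠ χ`, `hr ≤ P`);
* the `(d, r, h, θ)`-aggregation with the weight `D/(φ(hr)h√r)` of `rhs1417On`: `#θ* ≤ φ(r) ≤ r`,
  `hr/φ(hr) ≤ (1 + log hr)²` (`Sieve.natCast_div_totient_le`), `Σ_{h<P/r} 1/h ≤ 3𝓛⁹`, `#{r < D³} ≤ D³`,
  `Σ_{d≤2P₄} d(d)⁴/d ≤ (2𝓛⁹)¹⁶`, `𝓛¹⁷¹D⁷·D⁻⁹ ≪ D⁻¹`.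

| decl | content |
|---|---|
| `norm_kappa_mul_le_divisors` | (14.1) ⇒ `|κ*(dl)| ≤ B·d(d)⁴·d(l)⁴` |
| `norm_tsum_le_of_perTerm` | the `l`-series bound, generic prime weight `a`, generic dominated series `u` |
| `pow_four_le_bigT`, `pow_le_bigP` | `D⁴ ≤ T`, `D^A ≤ P` eventually |
| `norm_primeSum_chi_inv_DeltaW_le` | `‖Σ_{p∼P} χθ̄(p)Δ(l/(phr))‖ ≤ K·P²·D^{−A}·hr/l` (`1 < r < D³`, `θ` primitive, `θ ≠ χ`) |
| `smallConductor_tsum_le` | `‖Σ_l u(l)‖ ≤ C·d(d)⁴·hr·P²·D^{−A}` for any series dominated by `|κ*(dl)|·|Σ_p χθ̄(p)Δ(l/(phr))|` |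
| `eq148leg1_holds` | **`Typed.Sec14.Eq148leg1`** (by name) |

NOT here: the second range `D³ ≤ r < 2DP₄` (`Eq148leg2`, large sieve), the re-indexing `Step14u017`,
(14.5)/(14.6)/Proposition 14.1 themselves, Theorems 1–2, or anything about Landau–Siegel zeros.
Remark for the (14.8) assembler: `rhs1417On`/`Eq148leg1` sum over `r ∈ Ico 2 ⌈2DP₄⌉` (as typed); the
per-character lemma `smallConductor_tsum_le` is range-free in `r` (any `1 < r < D³`, `hr ≤ P`).

## References

* Y. Zhang, arXiv:2211.02515v1 (2022), §14 (14.8) and its proof sentence, p. 79, tex L3945–L3962; §7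
  (7.14) p. 38; §5 Lemmas 5.3, 5.4, 5.6 pp. 25–26. [cite: Zhang2022LandauSiegel, §14 (14.8) p.79]
-/

noncomputable section

open Complex Real

namespace Literature.NumberTheory.LFunctions.Zhang2022.Typed.Sec14

open Skeleton

/-! ## Arithmetic helpers: `τ₅ ≤ d⁴`, `d(mn) ≤ d(m)d(n)`, (14.1) in the form `|κ*(m)| ≤ B·d(m)⁴` -/

/-- `τ_{j+1}(n) ≤ d(n)^j` (local copy of the lane's helper). [folklore] -/
private theorem zeta_pow_succ_apply_le_card_divisors_pow₁ (j : ℕ) {n : ℕ} (hn : n ≠ 0) :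
    (ArithmeticFunction.zeta ^ (j + 1) : ArithmeticFunction ℕ) n ≤ n.divisors.card ^ j := by
  induction j generalizing n with
  | zero =>
      rw [zero_add, pow_one, ArithmeticFunction.zeta_apply, if_neg hn, pow_zero]
  | succ j ih =>
      rw [pow_succ, ArithmeticFunction.mul_zeta_apply]
      calc ∑ i ∈ n.divisors, (ArithmeticFunction.zeta ^ (j + 1) : ArithmeticFunction ℕ) i
          ≤ ∑ i ∈ n.divisors, n.divisors.card ^ j := by
            refine Finset.sum_le_sum fun i hi => ?_
            have hi0 : i ≠ 0 := Nat.pos_iff_ne_zero.mp (Nat.pos_of_mem_divisors hi)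
            refine (ih hi0).trans (Nat.pow_le_pow_left ?_ j)
            exact Finset.card_le_card (Nat.divisors_subset_of_dvd hn (Nat.dvd_of_mem_divisors hi))
        _ = n.divisors.card ^ (j + 1) := by rw [Finset.sum_const, smul_eq_mul, pow_succ']

/-- `τ₅(n) ≤ d(n)⁴` (as reals). [folklore] -/
private theorem zeta_pow_five_le_card_divisors_pow_four₁ (n : ℕ) :
    (((ArithmeticFunction.zeta ^ 5 : ArithmeticFunction ℕ) n : ℕ) : ℝ) ≤ (n.divisors.card : ℝ) ^ 4 := by
  rcases eq_or_ne n 0 with rfl | hn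
  · simp
  · exact_mod_cast zeta_pow_succ_apply_le_card_divisors_pow₁ 4 hn

/-- `d(mn) ≤ d(m)d(n)`. [folklore] -/
private theorem card_divisors_mul_le₁ (m n : ℕ) :
    (m * n).divisors.card ≤ m.divisors.card * n.divisors.card := by
  rw [Nat.divisors_mul]
  exact Finset.card_mul_le

/-- (14.1) in the form used here: `|κ*(dl)| ≤ B·d(d)⁴·d(l)⁴` (for `B ≥ 0`).
[cite: Zhang2022LandauSiegel, §14 (14.1) p.76] -/
theorem norm_kappa_mul_le_divisors {B : ℝ} (hB : 0 ≤ B) {κs : ℕ → ℂ} (hκ : Eq141 B κs) (d l : ℕ) :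
    ‖κs (d * l)‖ ≤ B * (d.divisors.card : ℝ) ^ 4 * (l.divisors.card : ℝ) ^ 4 := by
  have h1 := hκ (d * l)
  have h2 := zeta_pow_five_le_card_divisors_pow_four₁ (d * l)
  have h3 : ((d * l).divisors.card : ℝ) ^ 4 ≤ ((d.divisors.card : ℝ) * l.divisors.card) ^ 4 := by
    gcongr
    exact_mod_cast card_divisors_mul_le₁ d l
  calc ‖κs (d * l)‖ ≤ B * (((ArithmeticFunction.zeta ^ 5 : ArithmeticFunction ℕ) (d * l) : ℕ) : ℝ) := h1
    _ ≤ B * ((d * l).divisors.card : ℝ) ^ 4 := mul_le_mul_of_nonneg_left h2 hB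
    _ ≤ B * ((d.divisors.card : ℝ) * l.divisors.card) ^ 4 := mul_le_mul_of_nonneg_left h3 hB
    _ = B * (d.divisors.card : ℝ) ^ 4 * (l.divisors.card : ℝ) ^ 4 := by ring

/-- Under (14.1), `κ*(0) = 0` in norm: `‖κ*(0)‖ ≤ B·τ₅(0) = 0`. [cite: Zhang2022LandauSiegel, §14 (14.1) p.76] -/
theorem norm_kappa_zero_le {B : ℝ} {κs : ℕ → ℂ} (hκ : Eq141 B κs) : ‖κs 0‖ ≤ 0 := by
  have h1 := hκ 0
  rw [ArithmeticFunction.map_zero, Nat.cast_zero, mul_zero] at h1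
  exact h1

/-! ## Parameter facts -/

/-- `Σ_{l ≥ 1} 1/l² ≤ 2` in the form `∑' l, K/l² ≤ 2K` for `K ≥ 0` (from `ζ(2) = π²/6`). [folklore] -/
private theorem tsum_div_sq_le {K : ℝ} (hK : 0 ≤ K) :
    Summable (fun l : ℕ => K / (l : ℝ) ^ 2) ∧ ∑' l : ℕ, K / (l : ℝ) ^ 2 ≤ 2 * K := by
  have hs : Summable (fun l : ℕ => 1 / (l : ℝ) ^ 2) := Real.summable_one_div_nat_pow.mpr one_lt_two
  have heq : (fun l : ℕ => K / (l : ℝ) ^ 2) = fun l : ℕ => K * (1 / (l : ℝ) ^ 2) := by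
    funext l; ring
  rw [heq]
  refine ⟨hs.mul_left K, ?_⟩
  rw [(hasSum_zeta_two.mul_left K).tsum_eq]
  have hπ : π ^ 2 / 6 ≤ 2 := by nlinarith [Real.pi_lt_d2, Real.pi_pos]
  nlinarith

/-- The head/tail cut of the `l`-series: `N₀ = ⌊2P²t₀^{1.02}⌋`, with `1 + log N₀ ≤ 534𝓛⁹` (`𝓛 ≥ 1`).
[cite: Zhang2022LandauSiegel, §5 Lemma 5.3 (5.9); §2 (2.6), (2.8)] -/
theorem one_add_log_cut_le {D : ℕ} (hℓ : 1 ≤ ell D) :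
    1 + Real.log (⌊2 * bigP D ^ 2 * t0 D ^ (1.02 : ℝ)⌋₊ : ℕ) ≤ 534 * ell D ^ 9 := by
  obtain ⟨_, h530⟩ := t0_rpow_bounds hℓ
  have hℓ0 : 0 < ell D := by linarith
  have hP : bigP D = Real.exp (ell D ^ 9) := rfl
  have hP0 : 0 < bigP D := Real.exp_pos _
  have ht0 : 0 < t0 D ^ (1.02 : ℝ) := Real.rpow_pos_of_pos (by rw [t0]; positivity) _
  have hY0 : 0 < 2 * bigP D ^ 2 * t0 D ^ (1.02 : ℝ) := mul_pos (mul_pos two_pos (pow_pos hP0 2)) ht0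
  set Y : ℝ := 2 * bigP D ^ 2 * t0 D ^ (1.02 : ℝ) with hY
  have h9 : (1 : ℝ) ≤ ell D ^ 9 := one_le_pow₀ hℓ
  -- `log Y ≤ log 2 + 2𝓛⁹ + 530 log 𝓛 ≤ 1 + 2𝓛⁹ + 530𝓛`
  have hlogY : Real.log Y ≤ 533 * ell D ^ 9 := by
    have e1 : Real.log Y = Real.log 2 + 2 * ell D ^ 9 + Real.log (t0 D ^ (1.02 : ℝ)) := by
      rw [hY, Real.log_mul (by positivity) ht0.ne', Real.log_mul (by norm_num) (by positivity),
        Real.log_pow, hP, Real.log_exp]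
      push_cast; ring
    have e2 : Real.log (t0 D ^ (1.02 : ℝ)) ≤ 530 * ell D := by
      calc Real.log (t0 D ^ (1.02 : ℝ)) ≤ Real.log (ell D ^ 530) := Real.log_le_log ht0 h530
        _ = 530 * Real.log (ell D) := by rw [Real.log_pow]; push_cast; ring
        _ ≤ 530 * ell D := by
            have := Real.log_le_sub_one_of_pos hℓ0
            nlinarith
    have hlog2 : Real.log 2 ≤ 1 := by
      have := Real.log_le_sub_one_of_pos (show (0 : ℝ) < 2 by norm_num); linarith
    have e3 : ell D ≤ ell D ^ 9 := le_self_pow₀ hℓ (by norm_num)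
    rw [e1]; nlinarith
  rcases Nat.eq_zero_or_pos ⌊Y⌋₊ with h0 | hpos
  · rw [h0]; simp; nlinarith
  · have hfl : (⌊Y⌋₊ : ℝ) ≤ Y := Nat.floor_le hY0.le
    have : Real.log (⌊Y⌋₊ : ℝ) ≤ Real.log Y := Real.log_le_log (by exact_mod_cast hpos) hfl
    linarith

/-! ## The `l`-series at one character, for a GENERIC prime weight

The object bounded here is any series `Σ_l u(l)` dominated termwise by
`|κ*(dl)|·|Σ_{p∼P} a(p)Δ(l/(pX))|` — in the lane: `u(l) = [(l,h)=1]κ*(dl)θ(l)Σ_{p∼P}χθ̄(p)Δ(l/(phr))`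
(`X = hr`, `a(p) = χθ̄(p)`, the inner object of `rhs1417On`), or the same with the twist
`a(p) = χθ̄(p)(pt₀)^β` of the general-`β` Proposition 14.1, or the modulus-`D₂k` twin of (14.6). The two
inputs are the PER-TERM Mellin bound `|Σ_{p∼P} a(p)Δ(l/(pX))| ≤ G·X/l` (supplied by the tree's
`Skeleton.norm_sum_primeWindow_mul_DeltaW_le_of_bounds` from prime-sum bounds for `a`) for the head
`l ≤ 2P²t₀^{1.02}`, and Lemma 5.3 (5.9) for the tail, where only `|a(p)| ≤ A₀` is used. -/

/-- **The `l`-series bound, generic prime weight.** For `D ≥ 3` with `𝓛 ≥ 2`, the tail estimate (5.9)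
of Lemma 5.3 at `D` (constant `C ≥ 0`), `κ*` under (14.1) (constant `B ≥ 0`), a scale `1 ≤ X ≤ P`, a
prime weight `a` with `|a(p)| ≤ A₀` on the window and the per-term bound
`‖Σ_{p∼P} a(p)Δ(l/(pX))‖ ≤ G·X/l` (`l ≥ 1`), every series `Σ_l u(l)` with
`‖u(l)‖ ≤ ‖κ*(dl)‖·‖Σ_{p∼P} a(p)Δ(l/(pX))‖` satisfies
`‖Σ_l u(l)‖ ≤ B·d(d)⁴·(G·X·(534𝓛⁹)¹⁶ + 12·A₀·C·P)`
(head `l ≤ 2P²t₀^{1.02}`: `Σ d(l)⁴/l ≤ (1 + log N₀)¹⁶`; tail: `d(l)⁴|Δ(l/(pX))| ≤ 2C/l²`, `#{p ∼ P} ≤ 3P`,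
`Σ 1/l² ≤ 2`). [cite: Zhang2022LandauSiegel, §14 (14.8) p.79; §5 Lemma 5.3 (5.9) p.25] -/
theorem norm_tsum_le_of_perTerm {D : ℕ} (hD : 3 ≤ D) (hℓ2 : 2 ≤ ell D) {C : ℝ} (hC : 0 ≤ C)
    (h59 : ∀ x : ℝ, t0 D ^ (1.02 : ℝ) < x → ‖DeltaW D x‖ ≤
        C * (Real.exp (-((1 : ℝ) / 100 * ell2 D * Real.log x) ^ 2) +
          Real.exp (-(x ^ (0.99 : ℝ)) / ell2 D)))
    {B : ℝ} (hB : 0 ≤ B) {κs : ℕ → ℂ} (hκ : Eq141 B κs)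
    {X : ℝ} (hX1 : 1 ≤ X) (hXP : X ≤ bigP D)
    {a : ℕ → ℂ} {A₀ : ℝ} (hA₀ : 0 ≤ A₀) (ha : ∀ p ∈ primeWindow D, ‖a p‖ ≤ A₀)
    {G : ℝ} (hG0 : 0 ≤ G)
    (hG : ∀ l : ℕ, 1 ≤ l →
      ‖∑ p ∈ primeWindow D, a p * DeltaW D ((l : ℝ) / ((p : ℝ) * X))‖ ≤ G * X / l)
    (d : ℕ) {u : ℕ → ℂ}
    (hu : ∀ l : ℕ, ‖u l‖ ≤ ‖κs (d * l)‖ *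
      ‖∑ p ∈ primeWindow D, a p * DeltaW D ((l : ℝ) / ((p : ℝ) * X))‖) :
    ‖∑' l : ℕ, u l‖ ≤ B * (d.divisors.card : ℝ) ^ 4 *
      (G * X * (534 * ell D ^ 9) ^ 16 + 12 * A₀ * C * bigP D) := by
  classical
  have hℓ1 : 1 ≤ ell D := by linarith
  have hP0 : 0 < bigP D := Real.exp_pos _
  have hX0 : 0 < X := by linarith
  have ht0 : 0 < t0 D ^ (1.02 : ℝ) := Real.rpow_pos_of_pos (by rw [t0]; positivity) _
  set N₀ : ℕ := ⌊2 * bigP D ^ 2 * t0 D ^ (1.02 : ℝ)⌋₊ with hN₀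
  set τd : ℝ := (d.divisors.card : ℝ) ^ 4 with hτd
  have hτd0 : 0 ≤ τd := by positivity
  set K₁ : ℝ := B * τd * G * X with hK₁
  set K₂ : ℝ := B * τd * A₀ * (3 * bigP D) * (2 * C) with hK₂
  have hK₁0 : 0 ≤ K₁ := by positivity
  have hK₂0 : 0 ≤ K₂ := by positivity
  set M₁ : ℕ → ℝ := fun l => if l ∈ Finset.Icc 1 N₀ then K₁ * ((l.divisors.card : ℝ) ^ 4 / l) else 0
    with hM₁
  set M₂ : ℕ → ℝ := fun l => K₂ / (l : ℝ) ^ 2 with hM₂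
  have hM₁0 : ∀ l, 0 ≤ M₁ l := fun l => by
    simp only [hM₁]; split_ifs <;> positivity
  have hM₂0 : ∀ l, 0 ≤ M₂ l := fun l => by simp only [hM₂]; positivity
  -- the window
  have hcardW : ((primeWindow D).card : ℝ) ≤ 3 * bigP D := card_primeWindow_le hD
  have hpW : ∀ p ∈ primeWindow D, (1 : ℝ) ≤ p ∧ (p : ℝ) < 2 * bigP D := fun p hp =>
    ⟨by exact_mod_cast (Finset.mem_filter.mp hp).2.one_lt.le,
      Section7MainTerm.lt_two_mul_bigP_of_mem_primeWindow hℓ1 hp⟩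
  -- the inner sum, trivially bounded
  set S : ℕ → ℂ := fun l => ∑ p ∈ primeWindow D, a p * DeltaW D ((l : ℝ) / ((p : ℝ) * X)) with hS
  -- termwise domination
  have hle : ∀ l : ℕ, ‖u l‖ ≤ M₁ l + M₂ l := by
    intro l
    rcases Nat.eq_zero_or_pos l with rfl | hl
    · have h0 : ‖κs (d * 0)‖ ≤ 0 := by rw [mul_zero]; exact norm_kappa_zero_le hκ
      calc ‖u 0‖ ≤ ‖κs (d * 0)‖ * ‖S 0‖ := hu 0
        _ ≤ 0 * ‖S 0‖ := mul_le_mul_of_nonneg_right h0 (norm_nonneg _)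
        _ = 0 := zero_mul _
        _ ≤ M₁ 0 + M₂ 0 := add_nonneg (hM₁0 0) (hM₂0 0)
    have hκdl : ‖κs (d * l)‖ ≤ B * τd * (l.divisors.card : ℝ) ^ 4 :=
      norm_kappa_mul_le_divisors hB hκ d l
    have hl0 : (0 : ℝ) < l := by exact_mod_cast hl
    by_cases hlN : l ≤ N₀
    · -- head: the per-term Mellin bound
      have hmem : l ∈ Finset.Icc 1 N₀ := Finset.mem_Icc.mpr ⟨hl, hlN⟩
      have hM₁l : M₁ l = K₁ * ((l.divisors.card : ℝ) ^ 4 / l) := by simp only [hM₁, if_pos hmem]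
      calc ‖u l‖ ≤ ‖κs (d * l)‖ * ‖S l‖ := hu l
        _ ≤ (B * τd * (l.divisors.card : ℝ) ^ 4) * (G * X / l) :=
            mul_le_mul hκdl (hG l hl) (norm_nonneg _) (by positivity)
        _ = M₁ l := by rw [hM₁l, hK₁]; ring
        _ ≤ M₁ l + M₂ l := le_add_of_nonneg_right (hM₂0 l)
    · -- tail: Lemma 5.3 (5.9) at `x = l/(pX)` for each `p`
      have hlN' : N₀ < l := not_le.mp hlN
      have hYl : 2 * bigP D ^ 2 * t0 D ^ (1.02 : ℝ) < l := Nat.lt_of_floor_lt hlN'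
      have hterm : ∀ p ∈ primeWindow D,
          (l.divisors.card : ℝ) ^ 4 * ‖DeltaW D ((l : ℝ) / ((p : ℝ) * X))‖ ≤ 2 * C / (l : ℝ) ^ 2 := by
        intro p hp
        obtain ⟨hp1, hp2⟩ := hpW p hp
        have hpX1 : 1 ≤ (p : ℝ) * X := one_le_mul_of_one_le_of_one_le hp1 hX1
        have hpX0 : 0 < (p : ℝ) * X := by positivity
        have hpX2 : (p : ℝ) * X ≤ 2 * bigP D ^ 2 := by nlinarith
        have hlog : Real.log ((p : ℝ) * X) ≤ 5 * ell D ^ 9 := by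
          have h9 : (1 : ℝ) ≤ ell D ^ 9 := one_le_pow₀ hℓ1
          have hlog2 : Real.log 2 ≤ 1 := by
            have := Real.log_le_sub_one_of_pos (show (0 : ℝ) < 2 by norm_num); linarith
          calc Real.log ((p : ℝ) * X) ≤ Real.log (2 * bigP D ^ 2) := Real.log_le_log hpX0 hpX2
            _ = Real.log 2 + 2 * ell D ^ 9 := by
                rw [Real.log_mul (by norm_num) (by positivity), Real.log_pow, bigP, Real.log_exp]
                push_cast; ring
            _ ≤ 5 * ell D ^ 9 := by nlinarith
        have hlt : (p : ℝ) * X * t0 D ^ (1.02 : ℝ) < l := by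
          have : (p : ℝ) * X * t0 D ^ (1.02 : ℝ) ≤ 2 * bigP D ^ 2 * t0 D ^ (1.02 : ℝ) :=
            mul_le_mul_of_nonneg_right hpX2 ht0.le
          linarith
        have hx : t0 D ^ (1.02 : ℝ) < (l : ℝ) / ((p : ℝ) * X) := by
          rw [lt_div_iff₀ hpX0]; linarith
        exact divisors_pow_mul_norm_DeltaW_le_tail hC hℓ2 hpX1 hlog hlt (h59 _ hx)
      have hSl : (l.divisors.card : ℝ) ^ 4 * ‖S l‖ ≤
          A₀ * ((primeWindow D).card * (2 * C / (l : ℝ) ^ 2)) := by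
        calc (l.divisors.card : ℝ) ^ 4 * ‖S l‖
            ≤ (l.divisors.card : ℝ) ^ 4 *
                ∑ p ∈ primeWindow D, ‖a p‖ * ‖DeltaW D ((l : ℝ) / ((p : ℝ) * X))‖ := by
              refine mul_le_mul_of_nonneg_left ((norm_sum_le _ _).trans ?_) (by positivity)
              exact Finset.sum_le_sum fun p _ => (norm_mul_le _ _)
          _ ≤ (l.divisors.card : ℝ) ^ 4 *
                ∑ p ∈ primeWindow D, A₀ * ‖DeltaW D ((l : ℝ) / ((p : ℝ) * X))‖ := by
              refine mul_le_mul_of_nonneg_left (Finset.sum_le_sum fun p hp => ?_) (by positivity)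
              exact mul_le_mul_of_nonneg_right (ha p hp) (norm_nonneg _)
          _ = A₀ * ∑ p ∈ primeWindow D,
                (l.divisors.card : ℝ) ^ 4 * ‖DeltaW D ((l : ℝ) / ((p : ℝ) * X))‖ := by
              rw [Finset.mul_sum, Finset.mul_sum]
              exact Finset.sum_congr rfl fun p _ => by ring
          _ ≤ A₀ * ∑ p ∈ primeWindow D, 2 * C / (l : ℝ) ^ 2 :=
              mul_le_mul_of_nonneg_left (Finset.sum_le_sum hterm) hA₀
          _ = A₀ * ((primeWindow D).card * (2 * C / (l : ℝ) ^ 2)) := by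
              rw [Finset.sum_const, nsmul_eq_mul]
      have hd0 : 0 ≤ (l.divisors.card : ℝ) ^ 4 := by positivity
      calc ‖u l‖ ≤ ‖κs (d * l)‖ * ‖S l‖ := hu l
        _ ≤ (B * τd * (l.divisors.card : ℝ) ^ 4) * ‖S l‖ :=
            mul_le_mul_of_nonneg_right hκdl (norm_nonneg _)
        _ = B * τd * ((l.divisors.card : ℝ) ^ 4 * ‖S l‖) := by ring
        _ ≤ B * τd * (A₀ * ((primeWindow D).card * (2 * C / (l : ℝ) ^ 2))) :=
            mul_le_mul_of_nonneg_left hSl (by positivity)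
        _ ≤ B * τd * (A₀ * ((3 * bigP D) * (2 * C / (l : ℝ) ^ 2))) := by
            gcongr
        _ = M₂ l := by simp only [hM₂, hK₂]; ring
        _ ≤ M₁ l + M₂ l := le_add_of_nonneg_left (hM₁0 l)
  -- summability of the majorant
  have hM₁zero : ∀ l ∉ Finset.Icc 1 N₀, M₁ l = 0 := fun l hl => by simp only [hM₁, if_neg hl]
  have hM₁sum : Summable M₁ := summable_of_ne_finset_zero hM₁zero
  obtain ⟨hM₂sum, hM₂le⟩ := tsum_div_sq_le hK₂0
  have hMsum : Summable (fun l => M₁ l + M₂ l) := hM₁sum.add hM₂sum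
  have husum : Summable (fun l => ‖u l‖) :=
    Summable.of_nonneg_of_le (fun l => norm_nonneg _) hle hMsum
  -- the head sum
  have hM₁tsum : ∑' l, M₁ l ≤ K₁ * (534 * ell D ^ 9) ^ 16 := by
    rw [tsum_eq_sum hM₁zero]
    have e1 : ∑ l ∈ Finset.Icc 1 N₀, M₁ l =
        K₁ * ∑ l ∈ Finset.Icc 1 N₀, (l.divisors.card : ℝ) ^ 4 / l := by
      rw [Finset.mul_sum]
      exact Finset.sum_congr rfl fun l hl => by simp only [hM₁, if_pos hl]
    rw [e1]
    refine mul_le_mul_of_nonneg_left ?_ hK₁0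
    calc ∑ l ∈ Finset.Icc 1 N₀, (l.divisors.card : ℝ) ^ 4 / l
        ≤ (1 + Real.log N₀) ^ (2 ^ 4) := sum_card_divisors_pow_div_le_log_pow 4 N₀
      _ = (1 + Real.log N₀) ^ 16 := by norm_num
      _ ≤ (534 * ell D ^ 9) ^ 16 := by
          refine pow_le_pow_left₀ ?_ (one_add_log_cut_le hℓ1) 16
          have h0 : 0 ≤ Real.log ((⌊2 * bigP D ^ 2 * t0 D ^ (1.02 : ℝ)⌋₊ : ℕ) : ℝ) :=
            Real.log_natCast_nonneg _
          linarith
  -- assembling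
  calc ‖∑' l, u l‖ ≤ ∑' l, ‖u l‖ := norm_tsum_le_tsum_norm husum
    _ ≤ ∑' l, (M₁ l + M₂ l) := Summable.tsum_le_tsum hle husum hMsum
    _ = ∑' l, M₁ l + ∑' l, M₂ l := hM₁sum.tsum_add hM₂sum
    _ ≤ K₁ * (534 * ell D ^ 9) ^ 16 + 2 * K₂ := add_le_add hM₁tsum hM₂le
    _ = B * (d.divisors.card : ℝ) ^ 4 *
          (G * X * (534 * ell D ^ 9) ^ 16 + 12 * A₀ * C * bigP D) := by
        simp only [hK₁, hK₂, hτd]; ring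

/-! ## Scale facts: `D⁴ ≤ T`, `D^A ≤ P` eventually -/

/-- **`D⁴ ≤ T` for all large `D`** (`T = e^{𝓛^{1.1}}`, `D = e^{𝓛}`; for `𝓛 ≥ 2²⁰`, `𝓛^{0.1} ≥ 4`):
the moduli `Dr`, `r < D³`, of the first range of (14.8) lie below `T`, the range of Lemma 5.6.
[cite: Zhang2022LandauSiegel, §6 p.28 (definition of `T`); §14 (14.8) p.79] -/
theorem pow_four_le_bigT : ∃ D₀ : ℕ, ∀ D : ℕ, D₀ ≤ D → (D : ℝ) ^ 4 ≤ bigT D := by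
  obtain ⟨D₀, hD₀⟩ := exists_nat_forall_le_ell (1048576 : ℝ)
  refine ⟨max 1 D₀, fun D hD => ?_⟩
  have hD1 : 1 ≤ D := le_trans (le_max_left _ _) hD
  have hℓ := hD₀ D (le_trans (le_max_right _ _) hD)
  have hℓ0 : 0 < ell D := by linarith
  have hDexp : (D : ℝ) = Real.exp (ell D) := by
    rw [ell, Real.exp_log (by exact_mod_cast hD1)]
  have h01 : (4 : ℝ) ≤ ell D ^ (0.1 : ℝ) := by
    have h4 : (4 : ℝ) = (1048576 : ℝ) ^ (0.1 : ℝ) := by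
      rw [show (1048576 : ℝ) = 4 ^ (10 : ℝ) by norm_num, ← Real.rpow_mul (by norm_num)]
      norm_num
    rw [h4]
    exact Real.rpow_le_rpow (by norm_num) hℓ (by norm_num)
  have h11 : 4 * ell D ≤ ell D ^ (1.1 : ℝ) := by
    rw [show (1.1 : ℝ) = 1 + 0.1 by norm_num, Real.rpow_add hℓ0, Real.rpow_one]
    nlinarith
  calc (D : ℝ) ^ 4 = Real.exp (4 * ell D) := by rw [hDexp, ← Real.exp_nat_mul]; push_cast; ring_nf
    _ ≤ bigT D := by rw [bigT]; exact Real.exp_le_exp.mpr h11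

/-- **`D^A ≤ P` for all large `D`** (`P = e^{𝓛⁹}`, `A𝓛 ≤ 𝓛² ≤ 𝓛⁹` once `𝓛 ≥ max(1,A)`).
[cite: Zhang2022LandauSiegel, §2 (2.6)] -/
theorem pow_le_bigP (A : ℕ) : ∃ D₀ : ℕ, ∀ D : ℕ, D₀ ≤ D → (D : ℝ) ^ A ≤ bigP D := by
  obtain ⟨D₀, hD₀⟩ := exists_nat_forall_le_ell (max 1 (A : ℝ))
  refine ⟨max 1 D₀, fun D hD => ?_⟩
  have hD1 : 1 ≤ D := le_trans (le_max_left _ _) hD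
  have hℓ := hD₀ D (le_trans (le_max_right _ _) hD)
  have hℓ1 : 1 ≤ ell D := le_trans (le_max_left _ _) hℓ
  have hℓA : (A : ℝ) ≤ ell D := le_trans (le_max_right _ _) hℓ
  have hℓ0 : 0 ≤ ell D := by linarith
  have hDexp : (D : ℝ) = Real.exp (ell D) := by
    rw [ell, Real.exp_log (by exact_mod_cast hD1)]
  have hkey : (A : ℝ) * ell D ≤ ell D ^ 9 := by
    calc (A : ℝ) * ell D ≤ ell D * ell D := mul_le_mul_of_nonneg_right hℓA hℓ0
      _ = ell D ^ 2 := (sq _).symm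
      _ ≤ ell D ^ 9 := pow_le_pow_right₀ hℓ1 (by norm_num)
  calc (D : ℝ) ^ A = Real.exp ((A : ℝ) * ell D) := by rw [hDexp, ← Real.exp_nat_mul]
    _ ≤ bigP D := by rw [bigP]; exact Real.exp_le_exp.mpr hkey

/-! ## The per-term Mellin bound for the weight `χθ̄` (Lemma 5.4 (i) + Lemma 5.6), any power of `D` -/

/-- **Per-term bound with arbitrary power saving** (the §7.u033 REPAIRED route at the §14 weight):
for every `A` there is `K ≥ 0` such that, for all large `D` under (A), for `1 < r < D³`, `θ` primitive
`(mod r)` with `θ ≠ χ` (mod `Dr`), `h, l ≥ 1`: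
`‖Σ_{p∼P} χ(p)θ̄(p)Δ(l/(p·hr))‖ ≤ K·P²·D^{−A}·(hr)/l`. Route: the tree's exact-weight Mellin bound
`Skeleton.norm_sum_primeWindow_mul_DeltaW_le_of_bounds` (Lemma 5.4 (i) on `|t| ≤ D/2`, rapid decay of
`δ(1+it)` beyond) with the Lemma-5.6 input `Skeleton.lemma56_chi_mul_inv` (`Dr < D⁴ ≤ T`) and the
trivial `‖Σ_{p∼P} χθ̄(p)p^{1+it}‖ ≤ 𝔓 ≤ 4P²`. [cite: Zhang2022LandauSiegel, §14 (14.8) p.79, tex L3960–L3962; §5 Lemmas 5.4, 5.6] -/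
theorem norm_primeSum_chi_inv_DeltaW_le (A : ℕ) :
    ∃ K : ℝ, 0 ≤ K ∧ ForAllLarge fun D _ χ => AssumptionA D χ →
      ∀ (r h l : ℕ) (θ : DirichletCharacter ℂ r), 1 < r → (r : ℝ) < (D : ℝ) ^ 3 → 0 < h → 0 < l →
        θ.IsPrimitive →
        DirichletCharacter.changeLevel (dvd_mul_left r D) θ ≠
          DirichletCharacter.changeLevel (dvd_mul_right D r) χ →
        ‖∑ p ∈ primeWindow D, χ (p : ZMod D) * θ⁻¹ (p : ZMod r) *
            DeltaW D ((l : ℝ) / ((p : ℝ) * ((h * r : ℕ) : ℝ)))‖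
          ≤ K * bigP D ^ 2 * (D : ℝ) ^ (-(A : ℝ)) * ((h * r : ℕ) : ℝ) / l := by
  obtain ⟨CM, hM⟩ := norm_sum_primeWindow_mul_DeltaW_le_of_bounds A
  obtain ⟨C56, h56⟩ := lemma56_chi_mul_inv
  obtain ⟨DP, hP4⟩ := frakP_le_four_mul_bigP_sq
  obtain ⟨DT, hT⟩ := pow_four_le_bigT
  obtain ⟨Dℓ, hℓA⟩ := exists_nat_forall_le_ell ((A : ℝ) + 1)
  obtain ⟨D₀, hall⟩ := hM.and h56
  set K : ℝ := max CM 0 * ((max C56 0 * (Nat.factorial 2595 : ℝ) + 1) * 4) with hK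
  refine ⟨K, by positivity, D₀ + DP + DT + Dℓ + 3,
    fun D _ χ hD hq hp hA r h l θ hr hrD hh hl hθ hne => ?_⟩
  obtain ⟨hMD, h56D⟩ := hall D χ (by omega) hq hp
  have hD3 : 3 ≤ D := by omega
  have hD0 : (0 : ℝ) < D := by exact_mod_cast (show 0 < D by omega)
  haveI : NeZero r := ⟨by omega⟩
  have hr0 : (0 : ℝ) < r := by exact_mod_cast (show 0 < r by omega)
  -- `Dr < D⁴ ≤ T`
  have hDrT : (D : ℝ) * r < bigT D := by
    calc (D : ℝ) * r < (D : ℝ) * (D : ℝ) ^ 3 := mul_lt_mul_of_pos_left hrD hD0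
      _ = (D : ℝ) ^ 4 := by ring
      _ ≤ bigT D := hT D (by omega)
  -- the coefficients `a(p) = χ(p)θ̄(p)` and their prime-sum bounds
  set a : ℕ → ℂ := fun p => χ (p : ZMod D) * θ⁻¹ (p : ZMod r) with ha
  have hP0 : 0 ≤ frakP D := by
    rw [frakP_eq_sum_primeWindow]; exact Finset.sum_nonneg fun p _ => Nat.cast_nonneg p
  set E : ℝ := max C56 0 * frakP D * Real.exp (-(ell D ^ ((9 : ℝ) / 2))) with hE
  have hE0 : 0 ≤ E := by positivity
  have hFb : ∀ t : ℝ, ‖∑ p ∈ primeWindow D, a p * (p : ℂ) ^ (1 + (t : ℂ) * I)‖ ≤ frakP D := by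
    intro t
    rw [frakP_eq_sum_primeWindow]
    refine (norm_sum_le _ _).trans (Finset.sum_le_sum fun p hpw => ?_)
    have hpp : 0 < p := (Finset.mem_filter.mp hpw).2.pos
    have hre : (1 + (t : ℂ) * I).re = 1 := by simp
    rw [norm_mul, Complex.norm_natCast_cpow_of_pos hpp, hre, Real.rpow_one, ha, norm_mul]
    have h1 : ‖χ (p : ZMod D)‖ ≤ 1 := DirichletCharacter.norm_le_one _ _
    have h2 : ‖θ⁻¹ (p : ZMod r)‖ ≤ 1 := DirichletCharacter.norm_le_one _ _
    calc ‖χ (p : ZMod D)‖ * ‖θ⁻¹ (p : ZMod r)‖ * (p : ℝ) ≤ 1 * 1 * p := by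
          gcongr
      _ = p := by ring
  have hEb : ∀ t : ℝ, |t| ≤ (D : ℝ) / 2 →
      ‖∑ p ∈ primeWindow D, a p * (p : ℂ) ^ (1 + (t : ℂ) * I)‖ ≤ E := by
    intro t ht
    have htD : |t| ≤ D := ht.trans (by linarith)
    have h1 := h56D hA r hr hDrT θ hθ hne t htD
    have h2 : C56 * frakP D * Real.exp (-(ell D ^ ((9 : ℝ) / 2))) ≤ E := by
      rw [hE]
      have : 0 ≤ frakP D * Real.exp (-(ell D ^ ((9 : ℝ) / 2))) := by positivity
      calc C56 * frakP D * Real.exp (-(ell D ^ ((9 : ℝ) / 2)))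
          = C56 * (frakP D * Real.exp (-(ell D ^ ((9 : ℝ) / 2)))) := by ring
        _ ≤ max C56 0 * (frakP D * Real.exp (-(ell D ^ ((9 : ℝ) / 2)))) :=
            mul_le_mul_of_nonneg_right (le_max_left _ _) this
        _ = _ := by ring
    exact h1.trans h2
  -- the exact-weight Mellin bound at `c₀ = l/(hr)`
  have hhr0 : (0 : ℝ) < ((h * r : ℕ) : ℝ) := by exact_mod_cast Nat.mul_pos hh (by omega)
  have hl0 : (0 : ℝ) < l := by exact_mod_cast hl
  have hc₀ : 0 < (l : ℝ) / ((h * r : ℕ) : ℝ) := div_pos hl0 hhr0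
  have hmain := hMD a _ E (frakP D) hc₀ hE0 hP0 hEb hFb
  have harg : ∀ p : ℕ, (l : ℝ) / ((h * r : ℕ) : ℝ) / (p : ℝ) = (l : ℝ) / ((p : ℝ) * ((h * r : ℕ) : ℝ)) := by
    intro p; rw [div_div, mul_comm]
  simp_rw [harg] at hmain
  -- sizes of the two terms
  have hℓ' : (A : ℝ) + 1 ≤ ell D := hℓA D (by omega)
  have hexp := ell_pow_5190_mul_exp_neg_le hD3 A hℓ'
  have hDA0 : 0 ≤ (D : ℝ) ^ (-(A : ℝ)) := Real.rpow_nonneg hD0.le _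
  have hQ : E * ell D ^ 5190 + frakP D * (D : ℝ) ^ (-(A : ℝ)) ≤
      (max C56 0 * (Nat.factorial 2595 : ℝ) + 1) * 4 * (bigP D ^ 2 * (D : ℝ) ^ (-(A : ℝ))) := by
    have h1 : E * ell D ^ 5190 ≤
        max C56 0 * frakP D * ((Nat.factorial 2595 : ℝ) * (D : ℝ) ^ (-(A : ℝ))) := by
      rw [hE]
      calc max C56 0 * frakP D * Real.exp (-(ell D ^ ((9 : ℝ) / 2))) * ell D ^ 5190
          = max C56 0 * frakP D * (ell D ^ 5190 * Real.exp (-(ell D ^ ((9 : ℝ) / 2)))) := by ring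
        _ ≤ _ := mul_le_mul_of_nonneg_left hexp (by positivity)
    have hP4' := hP4 D (by omega)
    have h2 : max C56 0 * frakP D * ((Nat.factorial 2595 : ℝ) * (D : ℝ) ^ (-(A : ℝ))) +
        frakP D * (D : ℝ) ^ (-(A : ℝ)) =
        (max C56 0 * (Nat.factorial 2595 : ℝ) + 1) * (frakP D * (D : ℝ) ^ (-(A : ℝ))) := by ring
    calc E * ell D ^ 5190 + frakP D * (D : ℝ) ^ (-(A : ℝ))
        ≤ (max C56 0 * (Nat.factorial 2595 : ℝ) + 1) * (frakP D * (D : ℝ) ^ (-(A : ℝ))) := by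
          rw [← h2]; exact add_le_add h1 le_rfl
      _ ≤ (max C56 0 * (Nat.factorial 2595 : ℝ) + 1) * (4 * bigP D ^ 2 * (D : ℝ) ^ (-(A : ℝ))) := by
          refine mul_le_mul_of_nonneg_left ?_ (by positivity)
          exact mul_le_mul_of_nonneg_right hP4' hDA0
      _ = _ := by ring
  have hQ0 : 0 ≤ E * ell D ^ 5190 + frakP D * (D : ℝ) ^ (-(A : ℝ)) := by positivity
  have hinv : ((l : ℝ) / ((h * r : ℕ) : ℝ))⁻¹ = ((h * r : ℕ) : ℝ) / l := inv_div _ _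
  rw [hinv] at hmain
  have hhrl0 : 0 ≤ ((h * r : ℕ) : ℝ) / l := by positivity
  calc ‖∑ p ∈ primeWindow D, a p * DeltaW D ((l : ℝ) / ((p : ℝ) * ((h * r : ℕ) : ℝ)))‖
      ≤ CM * (((h * r : ℕ) : ℝ) / l) * (E * ell D ^ 5190 + frakP D * (D : ℝ) ^ (-(A : ℝ))) := hmain
    _ ≤ max CM 0 * (((h * r : ℕ) : ℝ) / l) * (E * ell D ^ 5190 + frakP D * (D : ℝ) ^ (-(A : ℝ))) := by
        have : 0 ≤ (((h * r : ℕ) : ℝ) / l) * (E * ell D ^ 5190 + frakP D * (D : ℝ) ^ (-(A : ℝ))) :=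
          mul_nonneg hhrl0 hQ0
        calc CM * (((h * r : ℕ) : ℝ) / l) * (E * ell D ^ 5190 + frakP D * (D : ℝ) ^ (-(A : ℝ)))
            = CM * ((((h * r : ℕ) : ℝ) / l) * (E * ell D ^ 5190 + frakP D * (D : ℝ) ^ (-(A : ℝ)))) := by
              ring
          _ ≤ max CM 0 * ((((h * r : ℕ) : ℝ) / l) *
                (E * ell D ^ 5190 + frakP D * (D : ℝ) ^ (-(A : ℝ)))) :=
              mul_le_mul_of_nonneg_right (le_max_left _ _) this
          _ = _ := by ring
    _ ≤ max CM 0 * (((h * r : ℕ) : ℝ) / l) *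
          ((max C56 0 * (Nat.factorial 2595 : ℝ) + 1) * 4 * (bigP D ^ 2 * (D : ℝ) ^ (-(A : ℝ)))) :=
        mul_le_mul_of_nonneg_left hQ (mul_nonneg (le_max_right _ _) hhrl0)
    _ = K * bigP D ^ 2 * (D : ℝ) ^ (-(A : ℝ)) * ((h * r : ℕ) : ℝ) / l := by
        rw [hK]; ring

/-! ## One character of small conductor: the `l`-series with a power saving -/

/-- **The `l`-series at a character of conductor `< D³`, any power of `D`.** For every `A`, `B` there
is `C ≥ 0` such that for all large `D` under (A), all `κ*` with (14.1) (constant `B`), all `d`, all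
`1 < r < D³`, `h ≥ 1` with `hr ≤ P`, every primitive `θ (mod r)` with `θ ≠ χ` (mod `Dr`), and every
series `Σ_l u(l)` dominated by `|κ*(dl)|·|Σ_{p∼P} χθ̄(p)Δ(l/(p·hr))|`:
`‖Σ_l u(l)‖ ≤ C·d(d)⁴·hr·P²·D^{−A}` — the §14 twin of the tree's `Section7cStatements.frakS_le_pow`
(per-term bound `norm_primeSum_chi_inv_DeltaW_le` at `A+1` in `norm_tsum_le_of_perTerm`, the tail by the
discharged Lemma 5.3 `Skeleton.lemma53_holds`; `534¹⁶𝓛¹⁴⁴ ≤ D` and `D^A ≤ P` absorb the rest).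
[cite: Zhang2022LandauSiegel, §14 (14.8) p.79, tex L3960–L3962; §5 Lemmas 5.3, 5.4, 5.6] -/
theorem smallConductor_tsum_le (A : ℕ) (B : ℝ) :
    ∃ C : ℝ, 0 ≤ C ∧ ForAllLarge fun D _ χ => AssumptionA D χ →
      ∀ κs : ℕ → ℂ, Eq141 B κs →
      ∀ (d r h : ℕ) (θ : DirichletCharacter ℂ r), 1 < r → (r : ℝ) < (D : ℝ) ^ 3 → 0 < h →
        ((h * r : ℕ) : ℝ) ≤ bigP D → θ.IsPrimitive →
        DirichletCharacter.changeLevel (dvd_mul_left r D) θ ≠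
          DirichletCharacter.changeLevel (dvd_mul_right D r) χ →
        ∀ u : ℕ → ℂ, (∀ l : ℕ, ‖u l‖ ≤ ‖κs (d * l)‖ *
          ‖∑ p ∈ primeWindow D, χ (p : ZMod D) * θ⁻¹ (p : ZMod r) *
              DeltaW D ((l : ℝ) / ((p : ℝ) * ((h * r : ℕ) : ℝ)))‖) →
        ‖∑' l : ℕ, u l‖ ≤ C * (d.divisors.card : ℝ) ^ 4 * ((h * r : ℕ) : ℝ) * bigP D ^ 2 *
          (D : ℝ) ^ (-(A : ℝ)) := by
  obtain ⟨K, hK0, DK, hK⟩ := norm_primeSum_chi_inv_DeltaW_le (A + 1)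
  obtain ⟨c53, hc53, C53, D53, h53⟩ := lemma53_holds
  obtain ⟨Dabs, habs⟩ := exists_mul_ell_pow_le 144 (show (0 : ℝ) ≤ 534 ^ 16 by positivity)
  obtain ⟨DA, hDA⟩ := pow_le_bigP A
  obtain ⟨Dℓ, hℓ2⟩ := exists_nat_forall_le_ell 2
  set B₀ : ℝ := max B 0 with hB₀
  set C₀ : ℝ := max C53 0 with hC₀
  refine ⟨B₀ * (K + 12 * C₀), by positivity, DK + D53 + Dabs + DA + Dℓ + 3,
    fun D _ χ hD hq hp hA κs hκ d r h θ hr hrD hh hhrP hθ hne u hu => ?_⟩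
  have hD3 : 3 ≤ D := by omega
  have hD0 : (0 : ℝ) < D := by exact_mod_cast (show 0 < D by omega)
  have hℓ2' : 2 ≤ ell D := hℓ2 D (by omega)
  have hℓ1 : 1 ≤ ell D := by linarith
  have hP0 : 0 < bigP D := Real.exp_pos _
  -- (14.1) with the non-negative constant `B₀`
  have hκ₀ : Eq141 B₀ κs := fun m =>
    (hκ m).trans (mul_le_mul_of_nonneg_right (le_max_left _ _) (Nat.cast_nonneg _))
  -- Lemma 5.3 (5.9) at `D`, with the non-negative constant `C₀`
  have ht0 : 0 < t0 D ^ (1.02 : ℝ) := Real.rpow_pos_of_pos (by rw [t0]; positivity) _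
  have h59 : ∀ x : ℝ, t0 D ^ (1.02 : ℝ) < x → ‖DeltaW D x‖ ≤
      C₀ * (Real.exp (-((1 : ℝ) / 100 * ell2 D * Real.log x) ^ 2) +
        Real.exp (-(x ^ (0.99 : ℝ)) / ell2 D)) := by
    intro x hx
    have hx0 : 0 < x := ht0.trans hx
    have h1 := (h53 D χ (by omega) hq hp x hx0).2 hx
    exact h1.trans (mul_le_mul_of_nonneg_right (le_max_left _ _) (by positivity))
  -- the scale `X = hr` and the weight `a = χθ̄`
  have hX1 : (1 : ℝ) ≤ ((h * r : ℕ) : ℝ) := by exact_mod_cast Nat.mul_pos hh (by omega)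
  have ha : ∀ p ∈ primeWindow D, ‖χ (p : ZMod D) * θ⁻¹ (p : ZMod r)‖ ≤ 1 := by
    intro p _
    rw [norm_mul]
    calc ‖χ (p : ZMod D)‖ * ‖θ⁻¹ (p : ZMod r)‖ ≤ 1 * 1 := by
          gcongr <;> exact DirichletCharacter.norm_le_one _ _
      _ = 1 := one_mul _
  set G : ℝ := K * bigP D ^ 2 * (D : ℝ) ^ (-((A + 1 : ℕ) : ℝ)) with hG
  have hG0 : 0 ≤ G := by positivity
  have hGl : ∀ l : ℕ, 1 ≤ l →
      ‖∑ p ∈ primeWindow D, χ (p : ZMod D) * θ⁻¹ (p : ZMod r) *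
          DeltaW D ((l : ℝ) / ((p : ℝ) * ((h * r : ℕ) : ℝ)))‖ ≤ G * ((h * r : ℕ) : ℝ) / l :=
    fun l hl => hK D χ (by omega) hq hp hA r h l θ hr hrD hh hl hθ hne
  -- the generic `l`-series bound
  have hmain := norm_tsum_le_of_perTerm hD3 hℓ2' (le_max_right _ _) h59 (le_max_right _ _) hκ₀
    hX1 hhrP zero_le_one ha hG0 hGl d hu
  -- absorbing `534¹⁶𝓛¹⁴⁴ ≤ D` and `P·D^A ≤ P²·X`
  set X : ℝ := ((h * r : ℕ) : ℝ) with hX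
  have hX0 : 0 ≤ X := by linarith
  have hDA0 : 0 ≤ (D : ℝ) ^ (-(A : ℝ)) := Real.rpow_nonneg hD0.le _
  have hsplit : (D : ℝ) ^ (-((A + 1 : ℕ) : ℝ)) = (D : ℝ) ^ (-(A : ℝ)) * ((D : ℝ))⁻¹ := by
    rw [show (-((A + 1 : ℕ) : ℝ)) = (-(A : ℝ)) + (-1) by push_cast; ring, Real.rpow_add hD0,
      Real.rpow_neg_one]
  have hhead : G * X * (534 * ell D ^ 9) ^ 16 ≤ K * (X * bigP D ^ 2 * (D : ℝ) ^ (-(A : ℝ))) := by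
    have habs' : 534 ^ 16 * ell D ^ 144 ≤ D := habs D (by omega)
    have h1 : (534 * ell D ^ 9) ^ 16 * ((D : ℝ))⁻¹ ≤ 1 := by
      rw [show (534 * ell D ^ 9) ^ 16 = 534 ^ 16 * ell D ^ 144 by ring]
      rw [mul_inv_le_iff₀ hD0, one_mul]
      exact habs'
    have hbase : 0 ≤ K * (X * bigP D ^ 2 * (D : ℝ) ^ (-(A : ℝ))) := by positivity
    calc G * X * (534 * ell D ^ 9) ^ 16
        = K * (X * bigP D ^ 2 * (D : ℝ) ^ (-(A : ℝ))) * ((534 * ell D ^ 9) ^ 16 * ((D : ℝ))⁻¹) := by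
          rw [hG, hsplit]; ring
      _ ≤ K * (X * bigP D ^ 2 * (D : ℝ) ^ (-(A : ℝ))) * 1 :=
          mul_le_mul_of_nonneg_left h1 hbase
      _ = _ := mul_one _
  have htail : 12 * (1 : ℝ) * C₀ * bigP D ≤ 12 * C₀ * (X * bigP D ^ 2 * (D : ℝ) ^ (-(A : ℝ))) := by
    have hDA' : (D : ℝ) ^ A ≤ bigP D := hDA D (by omega)
    have hDApos : 0 < (D : ℝ) ^ A := pow_pos hD0 A
    have h1 : 1 ≤ bigP D * (D : ℝ) ^ (-(A : ℝ)) := by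
      rw [Real.rpow_neg hD0.le, Real.rpow_natCast, ← div_eq_mul_inv, one_le_div hDApos]
      exact hDA'
    have h2 : bigP D ≤ X * bigP D ^ 2 * (D : ℝ) ^ (-(A : ℝ)) := by
      calc bigP D = 1 * bigP D * 1 := by ring
        _ ≤ X * bigP D * (bigP D * (D : ℝ) ^ (-(A : ℝ))) :=
            mul_le_mul (mul_le_mul_of_nonneg_right hX1 hP0.le) h1 zero_le_one (by positivity)
        _ = X * bigP D ^ 2 * (D : ℝ) ^ (-(A : ℝ)) := by ring
    have hC₀0 : 0 ≤ 12 * C₀ := by positivity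
    calc 12 * (1 : ℝ) * C₀ * bigP D = 12 * C₀ * bigP D := by ring
      _ ≤ 12 * C₀ * (X * bigP D ^ 2 * (D : ℝ) ^ (-(A : ℝ))) := mul_le_mul_of_nonneg_left h2 hC₀0
  have hd4 : 0 ≤ B₀ * (d.divisors.card : ℝ) ^ 4 := by positivity
  calc ‖∑' l : ℕ, u l‖
      ≤ B₀ * (d.divisors.card : ℝ) ^ 4 * (G * X * (534 * ell D ^ 9) ^ 16 + 12 * 1 * C₀ * bigP D) := hmain
    _ ≤ B₀ * (d.divisors.card : ℝ) ^ 4 * (K * (X * bigP D ^ 2 * (D : ℝ) ^ (-(A : ℝ))) +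
          12 * C₀ * (X * bigP D ^ 2 * (D : ℝ) ^ (-(A : ℝ)))) :=
        mul_le_mul_of_nonneg_left (add_le_add hhead htail) hd4
    _ = B₀ * (K + 12 * C₀) * (d.divisors.card : ℝ) ^ 4 * X * bigP D ^ 2 * (D : ℝ) ^ (-(A : ℝ)) := by
        ring

/-! ## (14.8), first `r`-range: the aggregation over `d`, `r < D³`, `h`, `θ` -/

/-- The harmonic bound on `Ico`: `Σ_{1 ≤ h < N} 1/h ≤ 1 + log N`. [folklore] -/
private theorem sum_Ico_one_div_le (N : ℕ) : ∑ h ∈ Finset.Ico 1 N, (1 : ℝ) / h ≤ 1 + Real.log N := by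
  calc ∑ h ∈ Finset.Ico 1 N, (1 : ℝ) / h ≤ ∑ h ∈ Finset.Icc 1 N, (1 : ℝ) / h :=
        Finset.sum_le_sum_of_subset_of_nonneg
          (fun h hh => by
            rw [Finset.mem_Ico] at hh; rw [Finset.mem_Icc]; omega)
          (fun _ _ _ => by positivity)
    _ ≤ 1 + Real.log N := sum_Icc_one_div_le_one_add_log N

set_option maxHeartbeats 400000 in
/-- **`Z22:(14.8)`, first `r`-range, HOLDS: `Typed.Sec14.Eq148leg1`** (p. 79, tex L3960–L3962: "for
`1 < r < D³` we use the Mellin transform, Lemma 5.4 (i) and Lemma 5.6") — the part `r < D³` of the u017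
majorant `rhs1417On` is `≤ P²·D^{−1}` for all large `D` under (A), for every `κ*` with (14.1) (and
every `a*`; (14.2) is not used). Per character: `smallConductor_tsum_le` with `A = 9`
(`u(l) = [(l,h)=1]κ*(dl)θ(l)Σ_{p∼P}χθ̄(p)Δ(l/(phr))`, `|θ(l)| ≤ 1`); then `#{θ* (mod r)} ≤ φ(r) ≤ r`,
`√r ≥ 1`, `hr/φ(hr) ≤ (1 + log hr)² ≤ 4𝓛¹⁸` (`hr < P`), `Σ_{h<P/r} 1/h ≤ 3𝓛⁹`, `#{r < D³} ≤ D³`,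
`Σ_{d ≤ 2P₄} d(d)⁴/d ≤ (2𝓛⁹)¹⁶`, and `12·2¹⁶·C·𝓛¹⁷¹·D⁷·D⁻⁹ ≤ D⁻¹` for `D` large. Constants: `c = 1`,
`C = 1`. No new definition; inputs: Lemma 5.3 (`lemma53_holds`), Lemma 5.4 (i) and the rapid decay of
`δ` (`Section7MellinPerTerm`), Lemma 5.6 (`lemma56_holds` via `lemma56_chi_mul_inv`), all tree theorems.
[cite: Zhang2022LandauSiegel, §14 (14.8) p.79, tex L3945–L3962] -/
theorem eq148leg1_holds : Eq148leg1 := by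
  classical
  intro B
  obtain ⟨C₀, hC₀0, DS, hS⟩ := smallConductor_tsum_le 9 B
  obtain ⟨DP4, hP4⟩ := exists_two_mul_P4_le_bigP
  obtain ⟨Dℓ, hℓ2⟩ := exists_nat_forall_le_ell 2
  obtain ⟨Dabs, habs⟩ := exists_mul_ell_pow_le 171 (show (0 : ℝ) ≤ 12 * 2 ^ 16 * C₀ by positivity)
  refine ⟨1, one_pos, 1, DS + DP4 + Dℓ + Dabs + 3, fun D _ χ hD hq hp hA κs as hκ _ => ?_⟩
  have hD3 : 3 ≤ D := by omega
  have hD0 : (0 : ℝ) < D := by exact_mod_cast (show 0 < D by omega)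
  have hD1 : (1 : ℝ) ≤ D := by exact_mod_cast (show 1 ≤ D by omega)
  have hℓ2' : 2 ≤ ell D := hℓ2 D (by omega)
  have hℓ1 : 1 ≤ ell D := by linarith
  have hP0 : 0 < bigP D := Real.exp_pos _
  have hP1 : 1 ≤ bigP D := Real.one_le_exp (by positivity)
  have hlogP : Real.log (bigP D) = ell D ^ 9 := by rw [bigP, Real.log_exp]
  have h9 : (2 : ℝ) ≤ ell D ^ 9 := le_trans hℓ2' (le_self_pow₀ hℓ1 (by norm_num))
  have hlog2 : Real.log 2 ≤ 1 := by
    have := Real.log_le_sub_one_of_pos (show (0 : ℝ) < 2 by norm_num); linarith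
  set L : ℝ := ell D with hL
  set P : ℝ := bigP D with hPdef
  set Sr : Finset ℕ := (Finset.Ico 2 ⌈2 * (D : ℝ) * P4 D⌉₊).filter (fun r => r < D ^ 3) with hSr
  -- the per-character bound, as a function of `(d, h, r)`
  set BND : ℕ → ℕ → ℕ → ℝ := fun d h r =>
    C₀ * (d.divisors.card : ℝ) ^ 4 * ((h * r : ℕ) : ℝ) * P ^ 2 * (D : ℝ) ^ (-((9 : ℕ) : ℝ)) with hBND
  have hBND0 : ∀ d h r, 0 ≤ BND d h r := fun d h r => by simp only [hBND]; positivity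
  -- Step 1: one character
  have hchar : ∀ (d r h : ℕ) (θ : DirichletCharacter ℂ r), r ∈ Sr →
      h ∈ (Finset.Ico 1 ⌈bigP D / r⌉₊).filter (fun h => D / Nat.gcd D r ∣ h) →
      θ ∈ finsetOf {θ : DirichletCharacter ℂ r | θ.IsPrimitive ∧
          DirichletCharacter.changeLevel (dvd_mul_left r D) θ ≠
            DirichletCharacter.changeLevel (dvd_mul_right D r) χ} →
      ‖∑' l : ℕ, if Nat.Coprime l h then
          κs (d * l) * θ (l : ZMod r) *
            ∑ p ∈ primeWindow D, χ (p : ZMod D) * θ⁻¹ (p : ZMod r) *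
              DeltaW D ((l : ℝ) / ((p : ℝ) * h * r)) else 0‖ ≤ BND d h r := by
    intro d r h θ hr hh hθ
    obtain ⟨hr1, hr3⟩ := Finset.mem_filter.mp hr
    have hr2 : 2 ≤ r := (Finset.mem_Ico.mp hr1).1
    obtain ⟨hh1, -⟩ := Finset.mem_filter.mp hh
    obtain ⟨hh0, hhP⟩ := Finset.mem_Ico.mp hh1
    obtain ⟨hθp, hne⟩ := mem_of_mem_finsetOf hθ
    have hr0 : (0 : ℝ) < r := by exact_mod_cast (show 0 < r by omega)
    have hrD : (r : ℝ) < (D : ℝ) ^ 3 := by exact_mod_cast hr3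
    have hhr : ((h * r : ℕ) : ℝ) ≤ bigP D := by
      have h1 : (h : ℝ) < bigP D / r := Nat.lt_ceil.mp hhP
      rw [lt_div_iff₀ hr0] at h1
      push_cast; exact h1.le
    have hSeq : ∀ l : ℕ, (∑ p ∈ primeWindow D, χ (p : ZMod D) * θ⁻¹ (p : ZMod r) *
        DeltaW D ((l : ℝ) / ((p : ℝ) * h * r))) =
        ∑ p ∈ primeWindow D, χ (p : ZMod D) * θ⁻¹ (p : ZMod r) *
          DeltaW D ((l : ℝ) / ((p : ℝ) * ((h * r : ℕ) : ℝ))) := by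
      intro l
      refine Finset.sum_congr rfl fun p _ => ?_
      simp only [Nat.cast_mul, mul_assoc]
    refine hS D χ (by omega) hq hp hA κs hκ d r h θ (by omega) hrD (by omega) hhr hθp hne _ ?_
    intro l
    rw [← hSeq l]
    split_ifs with hc
    · rw [norm_mul, norm_mul]
      calc ‖κs (d * l)‖ * ‖θ (l : ZMod r)‖ * _ ≤ ‖κs (d * l)‖ * 1 * _ := by
            gcongr; exact DirichletCharacter.norm_le_one _ _
        _ = _ := by rw [mul_one]
    · rw [norm_zero]; positivity
  -- Step 2: the sum over the characters at `(d, r, h)` is `≤ r · BND`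
  have hθsum : ∀ (d r h : ℕ), r ∈ Sr →
      h ∈ (Finset.Ico 1 ⌈bigP D / r⌉₊).filter (fun h => D / Nat.gcd D r ∣ h) →
      (∑ θ ∈ finsetOf {θ : DirichletCharacter ℂ r | θ.IsPrimitive ∧
          DirichletCharacter.changeLevel (dvd_mul_left r D) θ ≠
            DirichletCharacter.changeLevel (dvd_mul_right D r) χ},
        ‖∑' l : ℕ, if Nat.Coprime l h then
            κs (d * l) * θ (l : ZMod r) *
              ∑ p ∈ primeWindow D, χ (p : ZMod D) * θ⁻¹ (p : ZMod r) *
                DeltaW D ((l : ℝ) / ((p : ℝ) * h * r)) else 0‖) ≤ (r : ℝ) * BND d h r := by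
    intro d r h hr hh
    have hr2 : 2 ≤ r := (Finset.mem_Ico.mp (Finset.mem_filter.mp hr).1).1
    haveI : NeZero r := ⟨by omega⟩
    set T := finsetOf {θ : DirichletCharacter ℂ r | θ.IsPrimitive ∧
          DirichletCharacter.changeLevel (dvd_mul_left r D) θ ≠
            DirichletCharacter.changeLevel (dvd_mul_right D r) χ} with hT
    have h1 := Finset.sum_le_card_nsmul T _ (BND d h r) (fun θ hθ => hchar d r h θ hr hh hθ)
    rw [nsmul_eq_mul] at h1
    refine h1.trans (mul_le_mul_of_nonneg_right ?_ (hBND0 d h r))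
    have hcard : T.card ≤ Fintype.card (DirichletCharacter ℂ r) := Finset.card_le_univ _
    have htot : Fintype.card (DirichletCharacter ℂ r) = r.totient := by
      rw [← Nat.card_eq_fintype_card, DirichletCharacter.card_eq_totient_of_hasEnoughRootsOfUnity ℂ r]
    calc (T.card : ℝ) ≤ (Fintype.card (DirichletCharacter ℂ r) : ℝ) := by exact_mod_cast hcard
      _ = (r.totient : ℝ) := by rw [htot]
      _ ≤ r := by exact_mod_cast Nat.totient_le r
  -- Step 3: the weighted `(d, r, h)` term is `≤ M · d(d)⁴ · (1/h)`
  set M : ℝ := 4 * L ^ 18 * C₀ * P ^ 2 * (D : ℝ) ^ (-((9 : ℕ) : ℝ)) * (D : ℝ) * (D : ℝ) ^ 3 with hM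
  have hM0 : 0 ≤ M := by positivity
  have hterm : ∀ (d r h : ℕ), r ∈ Sr →
      h ∈ (Finset.Ico 1 ⌈bigP D / r⌉₊).filter (fun h => D / Nat.gcd D r ∣ h) →
      (D : ℝ) / ((Nat.totient (h * r) : ℝ) * h * Real.sqrt r) * ((r : ℝ) * BND d h r) ≤
        M * (d.divisors.card : ℝ) ^ 4 * (1 / (h : ℝ)) := by
    intro d r h hr hh
    obtain ⟨hr1, hr3⟩ := Finset.mem_filter.mp hr
    have hr2 : 2 ≤ r := (Finset.mem_Ico.mp hr1).1
    obtain ⟨hh1, -⟩ := Finset.mem_filter.mp hh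
    obtain ⟨hh0, hhP⟩ := Finset.mem_Ico.mp hh1
    have hr0 : (0 : ℝ) < r := by exact_mod_cast (show 0 < r by omega)
    have hh0' : (0 : ℝ) < h := by exact_mod_cast hh0
    have hrD : (r : ℝ) ≤ (D : ℝ) ^ 3 := by exact_mod_cast hr3.le
    have hhr0 : (0 : ℝ) < ((h * r : ℕ) : ℝ) := by exact_mod_cast Nat.mul_pos hh0 (by omega)
    have hhrP : ((h * r : ℕ) : ℝ) ≤ bigP D := by
      have h1 : (h : ℝ) < bigP D / r := Nat.lt_ceil.mp hhP
      rw [lt_div_iff₀ hr0] at h1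
      push_cast; exact h1.le
    have htot0 : (0 : ℝ) < (Nat.totient (h * r) : ℝ) := by
      exact_mod_cast Nat.totient_pos.2 (Nat.mul_pos hh0 (by omega))
    have hsqrt1 : (1 : ℝ) ≤ Real.sqrt r := by
      rw [show (1 : ℝ) = Real.sqrt 1 from Real.sqrt_one.symm]
      exact Real.sqrt_le_sqrt (by exact_mod_cast (show 1 ≤ r by omega))
    -- `hr ≤ 4𝓛¹⁸ φ(hr)`
    have hweight : ((h * r : ℕ) : ℝ) ≤ 4 * L ^ 18 * (Nat.totient (h * r) : ℝ) := by
      have hnat := Literature.NumberTheory.Sieve.natCast_div_totient_le (h * r)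
      rw [div_le_iff₀ htot0] at hnat
      have hlog : Real.log ((h * r : ℕ) : ℝ) ≤ L ^ 9 := by
        calc Real.log ((h * r : ℕ) : ℝ) ≤ Real.log (bigP D) := Real.log_le_log hhr0 hhrP
          _ = L ^ 9 := hlogP
      have hlog0 : 0 ≤ Real.log ((h * r : ℕ) : ℝ) := Real.log_natCast_nonneg _
      have h19 : (1 : ℝ) ≤ L ^ 9 := one_le_pow₀ hℓ1
      have hsq : (1 + Real.log ((h * r : ℕ) : ℝ)) ^ 2 ≤ 4 * L ^ 18 := by
        calc (1 + Real.log ((h * r : ℕ) : ℝ)) ^ 2 ≤ (2 * L ^ 9) ^ 2 :=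
              pow_le_pow_left₀ (by linarith) (by linarith) 2
          _ = 4 * L ^ 18 := by ring
      exact hnat.trans (mul_le_mul_of_nonneg_right hsq htot0.le)
    -- the comparison, cleared of denominators
    have hden : (0 : ℝ) < (Nat.totient (h * r) : ℝ) * h * Real.sqrt r := by positivity
    rw [div_mul_eq_mul_div, div_le_iff₀ hden]
    have hcore : (r : ℝ) * ((h * r : ℕ) : ℝ) * 1 ≤
        (D : ℝ) ^ 3 * (4 * L ^ 18 * (Nat.totient (h * r) : ℝ)) * Real.sqrt r :=
      mul_le_mul (mul_le_mul hrD hweight hhr0.le (by positivity)) hsqrt1 zero_le_one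
        (by positivity)
    have hfac : 0 ≤ (D : ℝ) * C₀ * (d.divisors.card : ℝ) ^ 4 * P ^ 2 *
        (D : ℝ) ^ (-((9 : ℕ) : ℝ)) := by positivity
    have hh1' : (1 / (h : ℝ)) * ((Nat.totient (h * r) : ℝ) * h * Real.sqrt r) =
        (Nat.totient (h * r) : ℝ) * Real.sqrt r := by
      field_simp
    calc (D : ℝ) * ((r : ℝ) * BND d h r)
        = ((D : ℝ) * C₀ * (d.divisors.card : ℝ) ^ 4 * P ^ 2 * (D : ℝ) ^ (-((9 : ℕ) : ℝ))) *
            ((r : ℝ) * ((h * r : ℕ) : ℝ) * 1) := by simp only [hBND]; ring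
      _ ≤ ((D : ℝ) * C₀ * (d.divisors.card : ℝ) ^ 4 * P ^ 2 * (D : ℝ) ^ (-((9 : ℕ) : ℝ))) *
            ((D : ℝ) ^ 3 * (4 * L ^ 18 * (Nat.totient (h * r) : ℝ)) * Real.sqrt r) :=
          mul_le_mul_of_nonneg_left hcore hfac
      _ = M * (d.divisors.card : ℝ) ^ 4 * ((Nat.totient (h * r) : ℝ) * Real.sqrt r) := by
          simp only [hM]; ring
      _ = M * (d.divisors.card : ℝ) ^ 4 * (1 / (h : ℝ)) *
            ((Nat.totient (h * r) : ℝ) * h * Real.sqrt r) := by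
          rw [mul_assoc (M * (d.divisors.card : ℝ) ^ 4) (1 / (h : ℝ)), hh1']
  -- Step 4: the sum over `h` at fixed `(d, r)`
  have hsumh : ∀ (d r : ℕ), r ∈ Sr →
      (∑ h ∈ (Finset.Ico 1 ⌈bigP D / r⌉₊).filter (fun h => D / Nat.gcd D r ∣ h),
        (D : ℝ) / ((Nat.totient (h * r) : ℝ) * h * Real.sqrt r) *
          ∑ θ ∈ finsetOf {θ : DirichletCharacter ℂ r | θ.IsPrimitive ∧
              DirichletCharacter.changeLevel (dvd_mul_left r D) θ ≠
                DirichletCharacter.changeLevel (dvd_mul_right D r) χ},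
            ‖∑' l : ℕ, if Nat.Coprime l h then
                κs (d * l) * θ (l : ZMod r) *
                  ∑ p ∈ primeWindow D, χ (p : ZMod D) * θ⁻¹ (p : ZMod r) *
                    DeltaW D ((l : ℝ) / ((p : ℝ) * h * r)) else 0‖) ≤
        M * (d.divisors.card : ℝ) ^ 4 * (3 * L ^ 9) := by
    intro d r hr
    have hr2 : 2 ≤ r := (Finset.mem_Ico.mp (Finset.mem_filter.mp hr).1).1
    have hr0 : (0 : ℝ) < r := by exact_mod_cast (show 0 < r by omega)
    set Hs := (Finset.Ico 1 ⌈bigP D / r⌉₊).filter (fun h => D / Nat.gcd D r ∣ h) with hHs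
    calc (∑ h ∈ Hs, (D : ℝ) / ((Nat.totient (h * r) : ℝ) * h * Real.sqrt r) * _)
        ≤ ∑ h ∈ Hs, (D : ℝ) / ((Nat.totient (h * r) : ℝ) * h * Real.sqrt r) * ((r : ℝ) * BND d h r) := by
          refine Finset.sum_le_sum fun h hh => ?_
          exact mul_le_mul_of_nonneg_left (hθsum d r h hr hh) (by positivity)
      _ ≤ ∑ h ∈ Hs, M * (d.divisors.card : ℝ) ^ 4 * (1 / (h : ℝ)) :=
          Finset.sum_le_sum fun h hh => hterm d r h hr hh
      _ ≤ ∑ h ∈ Finset.Ico 1 ⌈bigP D / r⌉₊, M * (d.divisors.card : ℝ) ^ 4 * (1 / (h : ℝ)) :=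
          Finset.sum_le_sum_of_subset_of_nonneg (Finset.filter_subset _ _)
            (fun _ _ _ => by positivity)
      _ = M * (d.divisors.card : ℝ) ^ 4 * ∑ h ∈ Finset.Ico 1 ⌈bigP D / r⌉₊, (1 / (h : ℝ)) := by
          rw [Finset.mul_sum]
      _ ≤ M * (d.divisors.card : ℝ) ^ 4 * (3 * L ^ 9) := by
          refine mul_le_mul_of_nonneg_left ?_ (by positivity)
          refine (sum_Ico_one_div_le _).trans ?_
          -- `⌈P/r⌉ ≤ P/2 + 1 ≤ 2P`, `log(2P) ≤ 1 + 𝓛⁹`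
          have hceil : (⌈bigP D / r⌉₊ : ℝ) ≤ 2 * bigP D := by
            have h1 : (⌈bigP D / r⌉₊ : ℝ) < bigP D / r + 1 := Nat.ceil_lt_add_one (by positivity)
            have h2 : bigP D / r ≤ bigP D := div_le_self hP0.le (by exact_mod_cast (show 1 ≤ r by omega))
            linarith
          rcases Nat.eq_zero_or_pos ⌈bigP D / r⌉₊ with h0 | hpos
          · rw [h0]; simp; nlinarith
          · have hlog : Real.log (⌈bigP D / r⌉₊ : ℝ) ≤ Real.log 2 + L ^ 9 := by
              calc Real.log (⌈bigP D / r⌉₊ : ℝ) ≤ Real.log (2 * bigP D) :=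
                    Real.log_le_log (by exact_mod_cast hpos) hceil
                _ = Real.log 2 + L ^ 9 := by rw [Real.log_mul (by norm_num) hP0.ne', hlogP]
            linarith
  -- Step 5: the sum over `r ∈ Sr` (at most `D³` terms)
  have hcardSr : (Sr.card : ℝ) ≤ (D : ℝ) ^ 3 := by
    have h1 : Sr ⊆ Finset.range (D ^ 3) := fun r hr => by
      rw [Finset.mem_range]; exact (Finset.mem_filter.mp hr).2
    have h2 := Finset.card_le_card h1
    rw [Finset.card_range] at h2
    exact_mod_cast h2
  have hsumr : ∀ d : ℕ,
      (∑ r ∈ Sr, ∑ h ∈ (Finset.Ico 1 ⌈bigP D / r⌉₊).filter (fun h => D / Nat.gcd D r ∣ h),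
        (D : ℝ) / ((Nat.totient (h * r) : ℝ) * h * Real.sqrt r) *
          ∑ θ ∈ finsetOf {θ : DirichletCharacter ℂ r | θ.IsPrimitive ∧
              DirichletCharacter.changeLevel (dvd_mul_left r D) θ ≠
                DirichletCharacter.changeLevel (dvd_mul_right D r) χ},
            ‖∑' l : ℕ, if Nat.Coprime l h then
                κs (d * l) * θ (l : ZMod r) *
                  ∑ p ∈ primeWindow D, χ (p : ZMod D) * θ⁻¹ (p : ZMod r) *
                    DeltaW D ((l : ℝ) / ((p : ℝ) * h * r)) else 0‖) ≤
        (D : ℝ) ^ 3 * (M * (d.divisors.card : ℝ) ^ 4 * (3 * L ^ 9)) := by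
    intro d
    have h1 := Finset.sum_le_card_nsmul Sr _ (M * (d.divisors.card : ℝ) ^ 4 * (3 * L ^ 9))
      (fun r hr => hsumh d r hr)
    rw [nsmul_eq_mul] at h1
    exact h1.trans (mul_le_mul_of_nonneg_right hcardSr (by positivity))
  -- Step 6: the sum over `d`
  have hlog2P4 : 1 + Real.log (⌊2 * P4 D⌋₊ : ℝ) ≤ 2 * L ^ 9 := by
    have hP4' : 2 * P4 D ≤ bigP D := hP4 D (by omega)
    rcases Nat.eq_zero_or_pos ⌊2 * P4 D⌋₊ with h0 | hpos
    · rw [h0]; simp; linarith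
    · have hT0 : 0 < bigT D := Real.exp_pos _
      have ht00 : 0 ≤ t0 D := by rw [t0]; exact pow_nonneg (by linarith) _
      have h2P4 : 0 ≤ 2 * P4 D := by rw [P4]; positivity
      have hfl : (⌊2 * P4 D⌋₊ : ℝ) ≤ bigP D := (Nat.floor_le h2P4).trans hP4'
      have : Real.log (⌊2 * P4 D⌋₊ : ℝ) ≤ L ^ 9 := by
        rw [← hlogP]; exact Real.log_le_log (by exact_mod_cast hpos) hfl
      linarith
  have hsumd : ∑ d ∈ Finset.Icc 1 ⌊2 * P4 D⌋₊, (d : ℝ)⁻¹ *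
      ((D : ℝ) ^ 3 * (M * (d.divisors.card : ℝ) ^ 4 * (3 * L ^ 9))) ≤
      (D : ℝ) ^ 3 * M * (3 * L ^ 9) * (2 * L ^ 9) ^ 16 := by
    have e1 : ∑ d ∈ Finset.Icc 1 ⌊2 * P4 D⌋₊, (d : ℝ)⁻¹ *
        ((D : ℝ) ^ 3 * (M * (d.divisors.card : ℝ) ^ 4 * (3 * L ^ 9))) =
        (D : ℝ) ^ 3 * M * (3 * L ^ 9) *
          ∑ d ∈ Finset.Icc 1 ⌊2 * P4 D⌋₊, (d.divisors.card : ℝ) ^ 4 / d := by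
      rw [Finset.mul_sum]
      exact Finset.sum_congr rfl fun d _ => by rw [div_eq_mul_inv]; ring
    rw [e1]
    refine mul_le_mul_of_nonneg_left ?_ (by positivity)
    calc ∑ d ∈ Finset.Icc 1 ⌊2 * P4 D⌋₊, (d.divisors.card : ℝ) ^ 4 / d
        ≤ (1 + Real.log (⌊2 * P4 D⌋₊ : ℝ)) ^ (2 ^ 4) := sum_card_divisors_pow_div_le_log_pow 4 _
      _ = (1 + Real.log (⌊2 * P4 D⌋₊ : ℝ)) ^ 16 := by norm_num
      _ ≤ (2 * L ^ 9) ^ 16 := by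
          refine pow_le_pow_left₀ ?_ hlog2P4 16
          have : 0 ≤ Real.log (⌊2 * P4 D⌋₊ : ℝ) := Real.log_natCast_nonneg _
          linarith
  -- Step 7: assembling and absorbing the powers of `𝓛`
  have hfinal : (D : ℝ) ^ 3 * M * (3 * L ^ 9) * (2 * L ^ 9) ^ 16 ≤
      1 * bigP D ^ 2 * (D : ℝ) ^ (-(1 : ℝ)) := by
    have habs' : 12 * 2 ^ 16 * C₀ * L ^ 171 ≤ D := habs D (by omega)
    have e9 : (D : ℝ) ^ (-((9 : ℕ) : ℝ)) = ((D : ℝ) ^ 9)⁻¹ := by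
      rw [Real.rpow_neg hD0.le, Real.rpow_natCast]
    have e1 : (D : ℝ) ^ (-(1 : ℝ)) = ((D : ℝ))⁻¹ := Real.rpow_neg_one _
    have eLHS : (D : ℝ) ^ 3 * M * (3 * L ^ 9) * (2 * L ^ 9) ^ 16 =
        (12 * 2 ^ 16 * C₀ * L ^ 171) * P ^ 2 * ((D : ℝ) ^ 7 * ((D : ℝ) ^ 9)⁻¹) := by
      simp only [hM]; rw [e9]; ring
    have e7 : (D : ℝ) ^ 7 * ((D : ℝ) ^ 9)⁻¹ = ((D : ℝ) ^ 2)⁻¹ := by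
      field_simp
    rw [eLHS, e7, e1, one_mul]
    -- goal: `K 𝓛¹⁷¹ · P² · (D²)⁻¹ ≤ P² · D⁻¹`
    have hD2 : (0 : ℝ) < (D : ℝ) ^ 2 := by positivity
    rw [show bigP D ^ 2 * ((D : ℝ))⁻¹ = (bigP D ^ 2 * D) * ((D : ℝ) ^ 2)⁻¹ by
      field_simp]
    refine mul_le_mul_of_nonneg_right ?_ (by positivity)
    calc 12 * 2 ^ 16 * C₀ * L ^ 171 * P ^ 2 = P ^ 2 * (12 * 2 ^ 16 * C₀ * L ^ 171) := by ring
      _ ≤ P ^ 2 * D := mul_le_mul_of_nonneg_left habs' (by positivity)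
      _ = bigP D ^ 2 * D := by rw [hPdef]
  -- the chain
  unfold rhs1417On
  calc ∑ d ∈ Finset.Icc 1 ⌊2 * P4 D⌋₊, (d : ℝ)⁻¹ * ∑ r ∈ Sr,
        ∑ h ∈ (Finset.Ico 1 ⌈bigP D / r⌉₊).filter (fun h => D / Nat.gcd D r ∣ h),
          (D : ℝ) / ((Nat.totient (h * r) : ℝ) * h * Real.sqrt r) *
            ∑ θ ∈ finsetOf {θ : DirichletCharacter ℂ r | θ.IsPrimitive ∧
                DirichletCharacter.changeLevel (dvd_mul_left r D) θ ≠
                  DirichletCharacter.changeLevel (dvd_mul_right D r) χ},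
              ‖∑' l : ℕ, if Nat.Coprime l h then
                  κs (d * l) * θ (l : ZMod r) *
                    ∑ p ∈ primeWindow D, χ (p : ZMod D) * θ⁻¹ (p : ZMod r) *
                      DeltaW D ((l : ℝ) / ((p : ℝ) * h * r)) else 0‖
      ≤ ∑ d ∈ Finset.Icc 1 ⌊2 * P4 D⌋₊, (d : ℝ)⁻¹ *
          ((D : ℝ) ^ 3 * (M * (d.divisors.card : ℝ) ^ 4 * (3 * L ^ 9))) := by
        refine Finset.sum_le_sum fun d _ => ?_
        exact mul_le_mul_of_nonneg_left (hsumr d) (by positivity)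
    _ ≤ (D : ℝ) ^ 3 * M * (3 * L ^ 9) * (2 * L ^ 9) ^ 16 := hsumd
    _ ≤ 1 * bigP D ^ 2 * (D : ℝ) ^ (-(1 : ℝ)) := hfinal

end Literature.NumberTheory.LFunctions.Zhang2022.Typed.Sec14
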